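import Summits.QuantumFields.YangMills.Theorems.UnitScaleTiltHalvingStubOfHP1RoomRho5
import Summits.QuantumFields.YangMills.Theorems.UnitScaleTiltHalvingP1FlatPillarRoomOfSuppliersRho5
import Summits.QuantumFields.YangMills.Theorems.UnitScaleTiltHalvingHSupURho5OfStokesRowS
import Summits.QuantumFields.YangMills.Theorems.UnitScaleTiltHalvingHStokesRowClosure
import HarnessLib

/-!
# Route `UnitScaleTilt`, crux K1 child «MinimiserStabilityRegPr» (stmt-QuantumFields-19200) — **THE REGISTERED STUB `stub_halvingStep` OF `BirthV10`, BY NAME**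
# ([Balaban1985Variational] Sect. F one-step halving at the d = 3 carriers), from LINE H's sorry-free chain:
# door ρ5 ✓p687803 `HalvingStubOfHP1RoomRho5.stub_halvingStep_of_hP1roomρ5` ∘ room ✓p687759 `HalvingP1FlatPillarRoomOfSuppliersRho5.hP1roomρ5_of_suppliers` ∘
# (σ8) ✓`HalvingHSupURho5OfStokesRowS.hSupUρ5_of_stokesRowS` (= ✓`hSupUρ5_of_memberPacks` ∘ the σ-edition Stokes-row packs ✓p703914∕✓p703915, px20 g5) applied TWICE to
# (σ9) ✓`HalvingHStokesRowClosure.hStokesL_holds` (px20 g5; the fat-loop Stokes row (b) CLOSED with no hypothesis over px15 g4's member knit ✓p703714 `hStokes_holds`) — NO socket: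
# the [4] Thm 3.1 letters (px9 ✓p689656), the (1.59)-type rows (px10 ✓p686552∕✓p687694∕✓p689061∕✓p690317), Theorem 4's datum (w7 ✓p693323 ∘ px3 ✓p689943 ∘ px9 ✓p691956) and the
# (1.42) collar residual (R33 assembly ✓p694481 (w8) ∘ composer v3.3 ∘ dictionary ✓p691497∕✓p691823 (ym-ust-20520-w5) ∘ LEMMA B-al (b)-row (★w3-19200 g10 lineage + px hands))
# all discharged IN THE PACKS on print's p. 98 sub-lattice, whose guards the ρ5 door pays).

Cell `ym3-torus` (HUMAN RULING D-0037, YM ladder rung R3 — YM₃ on T³ is a RUNG, NOT d = 4, NOT the Clay problem; the YM mass gap is NOT proved).  Width seat `ym-ust-19200-w5`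
gen 7 (successor LEAD-H g7).  Filed `--supports stmt-QuantumFields-19200` in STUB mode (★★OWNER g29 protocol 04:08:54Z): ONE theorem whose name and statement are the registered
skeleton's (`Cruxes/MinimiserStabilityRegPr/Lines/birth_v10.lean`, `BirthV10.stub_halvingStep`) VERBATIM; def-free, 0 sorry, standard axioms.  This closes the H stub ONLY; the crux
stmt-QuantumFields-19200 stays OPEN on `stub_existenceMinimalOrbit` (EX); nothing of the crux, the route, the rung or the gap is claimed.
References: T. Bałaban, CMP **102** (1985) 277–309 [Balaban1985Variational] Sect. F p.304, Prop. 8; CMP **99** (1985) 75–102 [Balaban1985RegularSpaces]; CMP **99** (1985) 389–434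
[Balaban1985BackgroundPropagators].
-/

set_option autoImplicit false

noncomputable section

open MeasureTheory Filter Topology
open scoped Matrix.Norms.L2Operator
open Literature.MathematicalPhysics.QuantumFieldTheory.Balaban1983to89
open Literature.MathematicalPhysics.QuantumFieldTheory.Balaban1983to89.T3ContinuumYM3Torus
open Literature.MathematicalPhysics.QuantumFieldTheory.Balaban1983to89.T3UnitLawDensityEML (ℰp measurableE_ℰp)
open Literature.MathematicalPhysics.QuantumFieldTheory.Balaban1983to89.T3UnitScaleTilt
open Literature.MathematicalPhysics.QuantumFieldTheory.Balaban1983to89.T3TiltDescent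
open Literature.MathematicalPhysics.QuantumFieldTheory.Balaban1983to89.T3CruxEstimates
open Literature.MathematicalPhysics.QuantumFieldTheory.Balaban1983to89.T3ConstrainedMinimiser
open Literature.MathematicalPhysics.QuantumFieldTheory.Balaban1983to89.T3DescentFibreTower
open Literature.MathematicalPhysics.QuantumFieldTheory.Balaban1983to89.T3MinimiserStabilityReduction
open Literature.MathematicalPhysics.QuantumFieldTheory.Balaban1983to89.T3RegularMinimiser
open Literature.MathematicalPhysics.QuantumFieldTheory.Balaban1983to89.T3PrintedRegularMinimiser
open Literature.MathematicalPhysics.QuantumFieldTheory.Balaban1983to89.T3PrintedRegularMinimiserReduction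
open Literature.MathematicalPhysics.QuantumFieldTheory.Balaban1983to89.T3PrintedMinimiserExistence
open Literature.MathematicalPhysics.QuantumFieldTheory.Balaban1983to89.T3Thm1Carrier
open Literature.MathematicalPhysics.QuantumFieldTheory.Balaban1983to89.T3Thm1CarrierNative (IsCritR2)

namespace Summit.QuantumFields.YangMills.Theorems.MinimiserStabilityRegPrStubHalvingStep

/-- ★★★★ **`BirthV10.stub_halvingStep` BY NAME — [Balaban1985Variational] Sect. F one-step halving at the d = 3 carriers** (registered text VERBATIM), from line H's
sorry-free chain (module docstring).  [cite: Balaban1985Variational, Sect. F p.304, Prop. 8; Balaban1985RegularSpaces, Thm 2 p.83, Prop. 3 pp.82-83, Thm 4 p.88; Balaban1985BackgroundPropagators, Thm 3.1 p.397, Thm 3.3 p.399] -/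
theorem stub_halvingStep : ∀ (L : ℕ), 1 < L → ∃ B₃ : ℝ, 4 < B₃ ∧ ∃ a₅ : ℝ, 0 < a₅ ∧
    ∀ (i : Idx L) (ε₀ ε₁ : ℝ), 0 < ε₁ → ∀ (V : (famX L i).Bdry) (U : (famX L i).Cfg), (famX L i).Reg7 ε₁ V → (famX L i).InU ε₀ U →
      (famX L i).InB V U → (famX L i).IsCritical V U → ε₀ ≤ a₅ → (famX L i).InU (max (B₃ * ε₁) (ε₀ / 2)) U :=
  HalvingStubOfHP1RoomRho5.stub_halvingStep_of_hP1roomρ5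
    (HalvingP1FlatPillarRoomOfSuppliersRho5.hP1roomρ5_of_suppliers
      (HalvingHSupURho5OfStokesRowS.hSupUρ5_of_stokesRowS HalvingHStokesRowClosure.hStokesL_holds HalvingHStokesRowClosure.hStokesL_holds))

/-- `Eq`-pin: the theorem above IS the registered skeleton decl's statement (definitional check against `BirthV10.stub_halvingStep`'s TYPE). -/
example : (∀ (L : ℕ), 1 < L → ∃ B₃ : ℝ, 4 < B₃ ∧ ∃ a₅ : ℝ, 0 < a₅ ∧
    ∀ (i : Idx L) (ε₀ ε₁ : ℝ), 0 < ε₁ → ∀ (V : (famX L i).Bdry) (U : (famX L i).Cfg), (famX L i).Reg7 ε₁ V → (famX L i).InU ε₀ U →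
      (famX L i).InB V U → (famX L i).IsCritical V U → ε₀ ≤ a₅ → (famX L i).InU (max (B₃ * ε₁) (ε₀ / 2)) U) := stub_halvingStep

end Summit.QuantumFields.YangMills.Theorems.MinimiserStabilityRegPrStubHalvingStep

end
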